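import Mathlib
import Literature.NumberTheory.Transcendental.OddZetaSeries
import Literature.NumberTheory.Transcendental.OddZetaSampling
import Literature.NumberTheory.Transcendental.ZetaLinearFormsCriterion
import Literature.NumberTheory.Transcendental.PeriodsWave0
import HarnessLib

/-!
# Odd zeta values IV: elimination over the lattices `(1/d)ℕ` and the conclusion

Final step of the elementary proof (Zudilin 2018; Sprang 2018; Fischler–Sprang–Zudilin 2019) that
infinitely many of `ζ(3), ζ(5), ζ(7), …` are irrational — this tree's named fact
`infinite_setOf_irrational_zetaValue_odd` (**periods.S19**-Corollary, `PeriodsWave0.lean`;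
Rivoal 2000, Ball–Rivoal 2001), whose discharge `infinite_setOf_irrational_zetaValue_odd_holds`
in `PeriodsWave0Proofs.lean` is the one-line application of
`setOf_irrational_zetaValue_odd_infinite` below. Ingredients:

* `OddZetaSeries.lean` (seat A): the twisted Ball–Rivoal function `OddZeta.Rfun r D s n`, its
  symmetrised integral partial-fraction expansion `OddZeta.exists_symm_exp`
  (`2 d_n^{s+1-i} b_{k,i} ∈ ℤ`, `∑_k b_{k,i} = 0` for even `i`) and `OddZeta.sum_coeff_one_eq_zero`;
* `OddZetaSampling.lean`: the sample series `S d = (1/d) ∑_{m ≥ 1} R_n(m/d)` over `(1/d)ℕ`,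
  `d ∣ D`, with `|S d - S d'| ≤ θ S D` for large `n` (`eventually_abs_S_sub_S_le`), `S D > 0`,
  `S d ≤ 2 Cₙ D^s`;
* `ZetaLinearFormsCriterion.lean`: the elementary irrationality criterion
  `exists_irrational_of_integerLinearForms`; `LcmUptoCubeBound.lean`: `d_m^3 ≤ K₀ 32^m`.

Contents:

* `hasSum_lattice`, `lattice_linear_forms`: summing the expansion over `(1/d)ℕ` gives
  `∑_{m ≥ 1} R_n(m/d) = ∑_{2 ≤ i ≤ s+1} P_i d^i ζ(i) - ρ_d` with `P_i = ∑_k b_{k,i}` independent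
  of `d`, `P_i = 0` for even `i`, and `2 d_{Dn}^{s+1}` clearing all denominators (Sprang 2018,
  Lemma 1.5 and §3, in the `d`-lattice form: the factor `d^i` in front of `ζ(i)` is what the
  elimination uses; `ζ(i) = zetaValue i` of `PeriodsWave0`);
* `exists_weights`: integers `w_0, …, w_N` with `∑_c w_c (2^c)^{2k+1} = 0` for `1 ≤ k ≤ N` and
  `∑_c w_c 2^c ≠ 0` (a column of the adjugate of the Vandermonde-type matrix `((2^c)^{2k+1})`,
  Sprang 2018, §3);
* the parameters `D = 2^N`, `r = 4^D`, `s + 1 = 6M`, `M = (2r+1)D (N + 4D + 2)`,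
  `K = 6·3^{1+2(s+1)}`: the window condition of `OddZetaSampling` holds (`window_holds`) and
  `d_{Dn}^{s+1} Cₙ ≤ K₀^{2M} (r+2) 2^{-n}` (`growth_bound`, via the power-of-two inequality
  `rate_ineq`);
* `exists_irrational_zetaValue_odd_gt`: with `Λ_n = ∑_c w_c ∑_{m≥1} R_n(m/2^c)` (`n` even), the
  forms `ℓ_n = 2 d_{Dn}^{s+1} Λ_n` are integer linear forms in `1` and the `ζ(i)`, `i` odd,
  `2N+3 ≤ i ≤ s+1` (even `i` drop by symmetry, odd `i ≤ 2N+1` by the weights), `ℓ_n → 0` by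
  `growth_bound`, and `ℓ_n ≠ 0` for large `n` because `Λ_n = W·S(D) + O(θ S(D))` with
  `W = ∑_c w_c 2^c ≠ 0` (the sampling estimate); the criterion gives an irrational `ζ(2k+1)`,
  `k > N`. Hence `setOf_irrational_zetaValue_odd_infinite`.

Everything is proved; the definitions are explicit constants/matrices only; no named facts.

## References
* [Sprang2018OddZeta] J. Sprang, Infinitely many odd zeta values are irrational. By elementary
  means, arXiv:1802.09410 (2018), Lemma 1.5, §3 (Theorem 3.1, Corollary 3.2).
* [Zudilin2018OddZeta] W. Zudilin, SIGMA 14 (2018) 028.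
* [FischlerSprangZudilin2019] S. Fischler, J. Sprang, W. Zudilin, Compositio Math. 155 (2019).
* [BallRivoal2001] K. Ball, T. Rivoal, Invent. Math. 146 (2001) 193–207.
* [Rivoal2000] T. Rivoal, C. R. Acad. Sci. Paris 331 (2000) 267–270.
-/

noncomputable section

open Finset Real

open scoped Nat

namespace Literature.NumberTheory.Transcendental

namespace OddZetaFinal

open OddZeta OddZetaSampling Filter Topology

/-! ### Harmonic-type sums and series over the lattice `(1/d)ℕ` -/

/-- `H i N = ∑_{q ≤ N} q^{-i}` (the `q = 0` term is Lean's `1/0^i = 0` for `i ≥ 1`, matching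
`zetaValue`). [folklore] -/
def H (i N : ℕ) : ℝ := ∑ q ∈ range (N + 1), 1 / (q : ℝ) ^ i

/-- `H i (N+M) = H i N + ∑_{m<M} (N+1+m)^{-i}`. [folklore] -/
theorem H_add (i N M : ℕ) :
    H i (N + M) = H i N + ∑ m ∈ range M, 1 / (((N + 1 + m : ℕ) : ℝ)) ^ i := by
  unfold H
  rw [show N + M + 1 = (N + 1) + M by ring, sum_range_add]

/-- `H i (M + N) → ζ(i)` as `M → ∞`, for `i ≥ 2`. [folklore] -/
theorem tendsto_H {i : ℕ} (hi : 2 ≤ i) (N : ℕ) :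
    Tendsto (fun M : ℕ => H i (M + N)) atTop (𝓝 (zetaValue i)) := by
  have hs : Summable (fun q : ℕ => 1 / (q : ℝ) ^ i) := Real.summable_one_div_nat_pow.mpr (by omega)
  have h := hs.hasSum.tendsto_sum_nat
  have h2 := h.comp (tendsto_add_atTop_nat (N + 1))
  unfold zetaValue H
  refine h2.congr fun M => ?_
  simp only [Function.comp_apply]
  rw [show M + (N + 1) = M + N + 1 by ring]

/-- `0 ≤ H 1 (M+N) - H 1 M ≤ N/(M+1)`. [folklore] -/
theorem H_one_sub_bounds (M N : ℕ) :
    0 ≤ H 1 (M + N) - H 1 M ∧ H 1 (M + N) - H 1 M ≤ N / ((M : ℝ) + 1) := by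
  rw [H_add, add_sub_cancel_left]
  refine ⟨sum_nonneg fun m _ => by positivity, ?_⟩
  calc ∑ m ∈ range N, 1 / (((M + 1 + m : ℕ) : ℝ)) ^ 1 ≤ ∑ _m ∈ range N, 1 / ((M : ℝ) + 1) := by
        refine sum_le_sum fun m _ => ?_
        rw [pow_one]
        exact one_div_le_one_div_of_le (by positivity)
          (by push_cast; linarith [(Nat.cast_nonneg (α := ℝ) m)])
    _ = N / ((M : ℝ) + 1) := by rw [sum_const, card_range]; simp [div_eq_mul_inv]

/-- Partial sums of an expansion over the lattice `(1/d)ℕ`: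
`∑_{m<M} pfEval b ((m+1)/d) = ∑_{k,i} b_{k,i} d^i (H i (dk+M) - H i (dk))`. [folklore] -/
theorem sum_pfEval_lattice {n p d : ℕ} (hd : 0 < d) (b : ℕ → ℕ → ℝ) (M : ℕ) :
    ∑ m ∈ range M, pfEval n p b (((m : ℝ) + 1) / d) =
      ∑ k ∈ range (n + 1), ∑ i ∈ Icc 1 p,
        b k i * (d : ℝ) ^ i * (H i (d * k + M) - H i (d * k)) := by
  have hd' : (0 : ℝ) < d := by exact_mod_cast hd
  unfold pfEval
  rw [sum_comm]
  refine sum_congr rfl fun k _ => ?_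
  rw [sum_comm]
  refine sum_congr rfl fun i _ => ?_
  rw [H_add, add_sub_cancel_left, mul_sum]
  refine sum_congr rfl fun m _ => ?_
  have : ((m : ℝ) + 1) / d + k = ((d * k + 1 + m : ℕ) : ℝ) / d := by
    push_cast; field_simp; ring
  rw [this, div_pow, div_div_eq_mul_div]
  ring

/-- **Series evaluation over the lattice `(1/d)ℕ`** (the mechanism of Zudilin 2018, Lemma 3 /
Sprang 2018, Lemma 1.5 / Fischler–Sprang–Zudilin 2019, Lemma 1, for sums over `m/d`): if
`g = pfEval b` on `(0, ∞)`, `∑_k b_{k,1} = 0` and `∑_m g((m+1)/d)` converges, then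
`∑_{m ≥ 0} g((m+1)/d) = ∑_k ∑_{i ≥ 2} b_{k,i} d^i (ζ(i) - H i (dk)) - ∑_k b_{k,1} d H 1 (dk)`.
[cite: Sprang2018OddZeta, Lemma 1.5] -/
theorem hasSum_lattice {n p d : ℕ} (hd : 0 < d) (hp : 1 ≤ p) {g : ℝ → ℝ} {b : ℕ → ℕ → ℝ}
    (hg : ∀ t : ℝ, 0 < t → g t = pfEval n p b t)
    (hsum : Summable (fun m : ℕ => g (((m : ℝ) + 1) / d)))
    (hb1 : ∑ k ∈ range (n + 1), b k 1 = 0) :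
    HasSum (fun m : ℕ => g (((m : ℝ) + 1) / d))
      (∑ k ∈ range (n + 1), ∑ i ∈ Icc 2 p, b k i * (d : ℝ) ^ i * (zetaValue i - H i (d * k)) -
        ∑ k ∈ range (n + 1), b k 1 * d * H 1 (d * k)) := by
  have hd' : (0 : ℝ) < d := by exact_mod_cast hd
  set f : ℕ → ℝ := fun m => g (((m : ℝ) + 1) / d) with hf
  have hpartial : ∀ M : ℕ, ∑ m ∈ range M, f m =
      ∑ k ∈ range (n + 1), ∑ i ∈ Icc 2 p, b k i * (d : ℝ) ^ i * (H i (d * k + M) - H i (d * k)) +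
        (d : ℝ) * ∑ k ∈ range (n + 1), b k 1 * (H 1 (M + d * k) - H 1 M) -
        ∑ k ∈ range (n + 1), b k 1 * d * H 1 (d * k) := by
    intro M
    have h1 : ∑ m ∈ range M, f m = ∑ m ∈ range M, pfEval n p b (((m : ℝ) + 1) / d) := by
      refine sum_congr rfl fun m _ => ?_
      exact hg _ (by positivity)
    rw [h1, sum_pfEval_lattice hd]
    have h2 : ∀ k ∈ range (n + 1),
        ∑ i ∈ Icc 1 p, b k i * (d : ℝ) ^ i * (H i (d * k + M) - H i (d * k)) =
          b k 1 * d * (H 1 (d * k + M) - H 1 (d * k)) +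
            ∑ i ∈ Icc 2 p, b k i * (d : ℝ) ^ i * (H i (d * k + M) - H i (d * k)) := by
      intro k _
      rw [sum_Icc_one_eq hp]
      ring
    rw [sum_congr rfl h2, sum_add_distrib]
    have h3 : ∑ k ∈ range (n + 1), b k 1 * d * (H 1 (d * k + M) - H 1 (d * k)) =
        (d : ℝ) * ∑ k ∈ range (n + 1), b k 1 * (H 1 (M + d * k) - H 1 M) +
          (d : ℝ) * H 1 M * ∑ k ∈ range (n + 1), b k 1 -
          ∑ k ∈ range (n + 1), b k 1 * d * H 1 (d * k) := by
      rw [mul_sum, mul_sum, ← sum_add_distrib, ← sum_sub_distrib]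
      refine sum_congr rfl fun k _ => ?_
      rw [add_comm (d * k) M]
      ring
    rw [h3, hb1, mul_zero, add_zero]
    ring
  have hlimA : Tendsto (fun M : ℕ => ∑ k ∈ range (n + 1), ∑ i ∈ Icc 2 p,
      b k i * (d : ℝ) ^ i * (H i (d * k + M) - H i (d * k))) atTop
      (𝓝 (∑ k ∈ range (n + 1), ∑ i ∈ Icc 2 p,
        b k i * (d : ℝ) ^ i * (zetaValue i - H i (d * k)))) := by
    refine tendsto_finsetSum _ fun k _ => tendsto_finsetSum _ fun i hi => ?_
    have hi2 : 2 ≤ i := (mem_Icc.mp hi).1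
    have := ((tendsto_H hi2 (d * k)).sub_const (H i (d * k))).const_mul (b k i * (d : ℝ) ^ i)
    refine this.congr fun M => ?_
    rw [add_comm M (d * k)]
  have hlimB : Tendsto (fun M : ℕ =>
      (d : ℝ) * ∑ k ∈ range (n + 1), b k 1 * (H 1 (M + d * k) - H 1 M)) atTop (𝓝 0) := by
    have : Tendsto (fun M : ℕ => ∑ k ∈ range (n + 1), b k 1 * (H 1 (M + d * k) - H 1 M))
        atTop (𝓝 (∑ k ∈ range (n + 1), b k 1 * 0)) := by
      refine tendsto_finsetSum _ fun k _ => ?_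
      refine tendsto_const_nhds.mul ?_
      have h0 : Tendsto (fun M : ℕ => ((d * k : ℕ) : ℝ) / ((M : ℝ) + 1)) atTop (𝓝 0) := by
        have := tendsto_const_div_atTop_nhds_zero_nat ((d * k : ℕ) : ℝ)
        refine (this.comp (tendsto_add_atTop_nat 1)).congr fun M => ?_
        simp
      exact squeeze_zero (fun M => (H_one_sub_bounds M (d * k)).1)
        (fun M => (H_one_sub_bounds M (d * k)).2) h0
    simpa using this.const_mul (d : ℝ)
  have hlim : Tendsto (fun M : ℕ => ∑ m ∈ range M, f m) atTop
      (𝓝 (∑ k ∈ range (n + 1), ∑ i ∈ Icc 2 p,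
          b k i * (d : ℝ) ^ i * (zetaValue i - H i (d * k)) +
        0 - ∑ k ∈ range (n + 1), b k 1 * d * H 1 (d * k))) := by
    have := (hlimA.add hlimB).sub_const (∑ k ∈ range (n + 1), b k 1 * d * H 1 (d * k))
    exact this.congr fun M => (hpartial M).symm
  rw [add_zero] at hlim
  have huniq := tendsto_nhds_unique hsum.hasSum.tendsto_sum_nat hlim
  rw [← huniq]
  exact hsum.hasSum

/-! ### The linear forms over the lattices `(1/d)ℕ` -/

/-- **Linear forms in `1` and odd zeta values from the lattice sums** (Sprang 2018, Lemma 1.5 and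
§3, for sums over `m/d` rather than `m + j/D`; same mechanism as `OddZeta.linear_forms`). Let
`n ≥ 1`, `L = (2r+1)Dn` even, `s` odd, `(2r+1)D + 2 ≤ s+1`, `r ≥ 1`. There are reals `P_i`
(independent of `d`) and `ρ_d` with `P_i = 0` for even `i`, `2 d_{Dn}^{s+1} P_i ∈ ℤ`,
`2 d_{Dn}^{s+1} ρ_d ∈ ℤ`, and for every `d ∣ D`

`∑_{m ≥ 1} R_n(m/d) = ∑_{2 ≤ i ≤ s+1} P_i d^i ζ(i) - ρ_d`.
[cite: Sprang2018OddZeta, Lemma 1.5 and §3] -/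
theorem lattice_linear_forms {r D s n : ℕ} (hn : 1 ≤ n) (hD : 0 < D) (hr : 1 ≤ r)
    (hL : Even (Lnum r D n)) (hs : Odd s) (hs' : (2 * r + 1) * D + 2 ≤ s + 1) :
    ∃ (P : ℕ → ℝ) (ρ : ℕ → ℝ),
      (∀ i, Even i → P i = 0) ∧
      (∀ i, IsZ (2 * dn (D * n) ^ (s + 1) * P i)) ∧
      (∀ d, d ∣ D → IsZ (2 * dn (D * n) ^ (s + 1) * ρ d)) ∧
      ∀ d, d ∣ D → HasSum (fun m : ℕ => Rfun r D s n (((m : ℝ) + 1) / d))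
          (∑ i ∈ Icc 2 (s + 1), P i * (d : ℝ) ^ i * zetaValue i - ρ d) := by
  obtain ⟨b, hbZ, hbeven, hbrep⟩ := exists_symm_exp hn hD hL hs (by omega)
  have hb1 : ∑ k ∈ range (n + 1), b k 1 = 0 :=
    sum_coeff_one_eq_zero hn hD hs' (p := s + 1) (by omega) (T := 0) fun t ht => hbrep t ht
  have hnN : n ≤ D * n := Nat.le_mul_of_pos_left n hD
  have hbZ' : ∀ k i, IsZ (2 * dn (D * n) ^ (s + 1 - i) * b k i) := by
    intro k i
    have e : 2 * dn (D * n) ^ (s + 1 - i) * b k i =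
        (2 * dn n ^ (s + 1 - i) * b k i) * (dn (D * n) / dn n) ^ (s + 1 - i) := by
      rw [div_pow]
      have : dn n ^ (s + 1 - i) ≠ 0 := pow_ne_zero _ (dn_pos n).ne'
      field_simp
    rw [e]
    exact (hbZ k i).mul ((isZ_dn_div_dn hnN).pow _)
  have hsplit : ∀ i, dn (D * n) ^ (s + 1) =
      dn (D * n) ^ (s + 1 - i) * dn (D * n) ^ (s + 1 - (s + 1 - i)) := by
    intro i; rw [← pow_add]; congr 1; omega
  refine ⟨fun i => ∑ k ∈ range (n + 1), b k i,
    fun d => ∑ k ∈ range (n + 1), ∑ i ∈ Icc 1 (s + 1), b k i * (d : ℝ) ^ i * H i (d * k),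
    fun i hi => hbeven i hi, fun i => ?_, fun d hd => ?_, fun d hd => ?_⟩
  · rw [mul_sum]
    refine IsZ.sum _ fun k _ => ?_
    rw [hsplit i, show 2 * (dn (D * n) ^ (s + 1 - i) * dn (D * n) ^ (s + 1 - (s + 1 - i))) * b k i =
      (2 * dn (D * n) ^ (s + 1 - i) * b k i) * dn (D * n) ^ (s + 1 - (s + 1 - i)) by ring]
    exact (hbZ' k i).mul ((isZ_dn _).pow _)
  · have hdD : d ≤ D := Nat.le_of_dvd hD hd
    rw [mul_sum]
    refine IsZ.sum _ fun k hk => ?_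
    have hkn : k ≤ n := by simpa [Nat.lt_succ_iff] using hk
    rw [mul_sum]
    refine IsZ.sum _ fun i hi => ?_
    obtain ⟨hi1, hia⟩ := mem_Icc.mp hi
    have hj : s + 1 - (s + 1 - i) = i := by omega
    rw [hsplit i, hj]
    have e : 2 * (dn (D * n) ^ (s + 1 - i) * dn (D * n) ^ i) * (b k i * (d : ℝ) ^ i * H i (d * k)) =
        (2 * dn (D * n) ^ (s + 1 - i) * b k i) * (d : ℝ) ^ i * (dn (D * n) ^ i * H i (d * k)) := by
      ring
    rw [e]
    refine ((hbZ' k i).mul ((IsZ.nat d).pow i)).mul ?_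
    unfold H
    rw [mul_sum]
    refine IsZ.sum _ fun q hq => ?_
    have hqk : q ≤ d * k := Nat.lt_succ_iff.mp (mem_range.mp hq)
    rcases Nat.eq_zero_or_pos q with h0 | hq1
    · subst h0
      simp [zero_pow (by omega : i ≠ 0), IsZ.zero]
    · have hqN : q ≤ D * n := hqk.trans (Nat.mul_le_mul hdD hkn)
      have := (isZ_dn_div_nat hq1 hqN).pow i
      rw [div_pow] at this
      convert this using 1
      ring
  · have hd0 : 0 < d := Nat.pos_of_dvd_of_pos hd hD
    have hsum : Summable (fun m : ℕ => Rfun r D s n (((m : ℝ) + 1) / d)) :=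
      summable_term (n := n) hD hd hr hs'
    have h := hasSum_lattice hd0 (by omega : 1 ≤ s + 1) hbrep hsum hb1
    convert h using 1
    dsimp only
    set X := ∑ k ∈ range (n + 1), ∑ i ∈ Icc 2 (s + 1), b k i * (d : ℝ) ^ i * zetaValue i with hX
    set Y := ∑ k ∈ range (n + 1), b k 1 * (d : ℝ) * H 1 (d * k) with hY
    set Z := ∑ k ∈ range (n + 1), ∑ i ∈ Icc 2 (s + 1), b k i * (d : ℝ) ^ i * H i (d * k) with hZ
    have e1 : ∑ i ∈ Icc 2 (s + 1), (∑ k ∈ range (n + 1), b k i) * (d : ℝ) ^ i * zetaValue i = X := by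
      rw [hX, sum_comm]
      refine sum_congr rfl fun i _ => ?_
      rw [sum_mul, sum_mul]
    have e2 : ∑ k ∈ range (n + 1), ∑ i ∈ Icc 1 (s + 1), b k i * (d : ℝ) ^ i * H i (d * k) = Y + Z := by
      rw [hY, hZ, ← sum_add_distrib]
      refine sum_congr rfl fun k _ => ?_
      rw [sum_Icc_one_eq (by omega : 1 ≤ s + 1), pow_one]
    have e3 : ∑ k ∈ range (n + 1), ∑ i ∈ Icc 2 (s + 1),
        b k i * (d : ℝ) ^ i * (zetaValue i - H i (d * k)) = X - Z := by
      rw [hX, hZ, ← sum_sub_distrib]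
      refine sum_congr rfl fun k _ => ?_
      rw [← sum_sub_distrib]
      refine sum_congr rfl fun i _ => ?_
      ring
    rw [e1, e2, e3]
    ring

/-! ### The elimination weights -/

/-- The matrix `M_{k,c} = (2^c)^{2k+1}`, `k, c ≤ N`. [folklore] -/
def elimMatrix (N : ℕ) : Matrix (Fin (N + 1)) (Fin (N + 1)) ℤ :=
  Matrix.of fun k c => ((2 : ℤ) ^ (c : ℕ)) ^ (2 * (k : ℕ) + 1)

/-- `(2^c)^{2k+1} = 2^c (4^c)^k`. [folklore] -/
theorem two_pow_pow_odd (c k : ℕ) : ((2 : ℤ) ^ c) ^ (2 * k + 1) = 2 ^ c * (4 ^ c) ^ k := by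
  have h4 : ((2 : ℤ) ^ c) ^ 2 = 4 ^ c := by
    rw [← pow_mul, mul_comm, pow_mul]; norm_num
  rw [pow_succ, pow_mul, h4]
  ring

/-- `det M ≠ 0`: `Mᵀ = diag(2^c) · Vandermonde(4^c)`. [folklore] -/
theorem det_elimMatrix_ne_zero (N : ℕ) : (elimMatrix N).det ≠ 0 := by
  have hT : (elimMatrix N).transpose =
      Matrix.diagonal (fun c : Fin (N + 1) => (2 : ℤ) ^ (c : ℕ)) *
        Matrix.vandermonde (fun c : Fin (N + 1) => (4 : ℤ) ^ (c : ℕ)) := by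
    ext c k
    simp only [elimMatrix, Matrix.transpose_apply, Matrix.of_apply, Matrix.diagonal_mul,
      Matrix.vandermonde_apply, two_pow_pow_odd]
  rw [← Matrix.det_transpose, hT, Matrix.det_mul, Matrix.det_diagonal]
  refine mul_ne_zero (Finset.prod_ne_zero_iff.mpr fun c _ => pow_ne_zero _ two_ne_zero) ?_
  rw [Matrix.det_vandermonde_ne_zero_iff]
  intro i j hij
  have h : (4 : ℤ) ^ (i : ℕ) = 4 ^ (j : ℕ) := hij
  have h' : (4 : ℕ) ^ (i : ℕ) = 4 ^ (j : ℕ) := by exact_mod_cast h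
  exact Fin.ext (Nat.pow_right_injective (by norm_num : 2 ≤ 4) h')

/-- **Elimination weights** (Sprang 2018, §3: `w = det(M) e M⁻¹`): integers `w_0, …, w_N` with
`∑_c w_c 2^c ≠ 0` and `∑_c w_c (2^c)^{2k+1} = 0` for `1 ≤ k ≤ N`. [cite: Sprang2018OddZeta, §3 (proof of Theorem 3.1)] -/
theorem exists_weights (N : ℕ) : ∃ w : ℕ → ℤ,
    (∑ c ∈ range (N + 1), w c * 2 ^ c ≠ 0) ∧
    ∀ k, 1 ≤ k → k ≤ N → ∑ c ∈ range (N + 1), w c * (2 ^ c) ^ (2 * k + 1) = 0 := by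
  set M := elimMatrix N with hM
  set w : Fin (N + 1) → ℤ := fun c => M.adjugate c 0 with hw
  have key : ∀ k : Fin (N + 1), ∑ c : Fin (N + 1), M k c * w c = if k = 0 then M.det else 0 := by
    intro k
    have h := congrFun (congrFun (Matrix.mul_adjugate M) k) 0
    rw [Matrix.mul_apply, Matrix.smul_apply, Matrix.one_apply, smul_eq_mul, mul_ite, mul_one,
      mul_zero] at h
    exact h
  set w' : ℕ → ℤ := fun c => if h : c < N + 1 then w ⟨c, h⟩ else 0 with hw'
  have hsum : ∀ e : ℕ, ∑ c ∈ range (N + 1), w' c * (2 ^ c) ^ e =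
      ∑ c : Fin (N + 1), ((2 : ℤ) ^ (c : ℕ)) ^ e * w c := by
    intro e
    rw [Finset.sum_range]
    refine Finset.sum_congr rfl fun c _ => ?_
    simp only [hw', dif_pos c.isLt, Fin.eta]
    ring
  refine ⟨w', ?_, fun k hk1 hkN => ?_⟩
  · have h0 := key 0
    rw [if_pos rfl] at h0
    have e : ∑ c ∈ range (N + 1), w' c * 2 ^ c = ∑ c ∈ range (N + 1), w' c * (2 ^ c) ^ 1 := by
      simp
    rw [e, hsum 1]
    have : ∑ c : Fin (N + 1), ((2 : ℤ) ^ (c : ℕ)) ^ 1 * w c = ∑ c : Fin (N + 1), M 0 c * w c := by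
      refine Finset.sum_congr rfl fun c _ => ?_
      simp [hM, elimMatrix]
    rw [this, h0]
    exact det_elimMatrix_ne_zero N
  · have hk : k < N + 1 := by omega
    have hne : (⟨k, hk⟩ : Fin (N + 1)) ≠ 0 := by
      intro h
      have := congrArg Fin.val h
      simp at this
      omega
    have h1 := key ⟨k, hk⟩
    rw [if_neg hne] at h1
    rw [hsum (2 * k + 1)]
    have : ∑ c : Fin (N + 1), ((2 : ℤ) ^ (c : ℕ)) ^ (2 * k + 1) * w c =
        ∑ c : Fin (N + 1), M ⟨k, hk⟩ c * w c := by
      refine Finset.sum_congr rfl fun c _ => ?_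
      simp [hM, elimMatrix]
    rw [this, h1]

/-! ### Parameters -/

/-- `D = 2^N`. [folklore] -/
def pD (N : ℕ) : ℕ := 2 ^ N

/-- `r = 4^D`. [folklore] -/
def pr (N : ℕ) : ℕ := 4 ^ pD N

/-- `B = (2r+1)D`, the number of numerator blocks. [folklore] -/
def pB (N : ℕ) : ℕ := (2 * pr N + 1) * pD N

/-- `M = B (N + 4D + 2)`; the pole order is `s + 1 = 6M`. [folklore] -/
def pM (N : ℕ) : ℕ := pB N * (N + 4 * pD N + 2)

/-- `s = 6M - 1` (odd, `3 ∣ s+1`). [folklore] -/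
def ps (N : ℕ) : ℕ := 6 * pM N - 1

/-- `K = 6 · 3^{1+2(s+1)}`, the window parameter. [folklore] -/
def pK (N : ℕ) : ℕ := 6 * 3 ^ (1 + 2 * (ps N + 1))

/-- `D ≥ 1`. [folklore] -/
theorem pD_pos (N : ℕ) : 0 < pD N := by unfold pD; positivity

/-- `r ≥ 4`. [folklore] -/
theorem four_le_pr (N : ℕ) : 4 ≤ pr N := by
  unfold pr
  calc 4 = 4 ^ 1 := by norm_num
    _ ≤ 4 ^ pD N := Nat.pow_le_pow_right (by norm_num) (pD_pos N)

/-- `B ≥ 1`. [folklore] -/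
theorem pB_pos (N : ℕ) : 1 ≤ pB N := by
  unfold pB
  exact Nat.one_le_iff_ne_zero.mpr (Nat.mul_ne_zero (by omega) (pD_pos N).ne')

/-- `M ≥ 6B`. [folklore] -/
theorem pM_ge (N : ℕ) : 6 * pB N ≤ pM N := by
  unfold pM
  have := pD_pos N
  nlinarith

/-- `s + 1 = 6M`. [folklore] -/
theorem ps_succ (N : ℕ) : ps N + 1 = 6 * pM N := by
  unfold ps
  have := pM_ge N
  have := pB_pos N
  omega

/-- `s` is odd. [folklore] -/
theorem ps_odd (N : ℕ) : Odd (ps N) := by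
  have h := ps_succ N
  have : ps N = 2 * (3 * pM N - 1) + 1 := by
    have := pM_ge N; have := pB_pos N; omega
  rw [this]; exact odd_two_mul_add_one _

/-- `(2r+1)D + 2 ≤ s + 1`. [folklore] -/
theorem ps_large (N : ℕ) : (2 * pr N + 1) * pD N + 2 ≤ ps N + 1 := by
  rw [ps_succ]
  have h := pM_ge N
  have hB := pB_pos N
  have e : (2 * pr N + 1) * pD N = pB N := rfl
  rw [e]
  omega

/-- `K ≥ 1`. [folklore] -/
theorem pK_pos (N : ℕ) : 0 < pK N := by unfold pK; positivity

/-- **The window condition** `1 + 2(s+1)/r ≤ D log(rK/6)` holds for the chosen parameters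
(`rK/6 ≥ 3^{1+2(s+1)}` and `log 3 ≥ 1`). [folklore] -/
theorem window_holds (N : ℕ) :
    1 + 2 * ((ps N : ℝ) + 1) / pr N ≤ (pD N : ℝ) * Real.log ((pr N : ℝ) * pK N / 6) := by
  have hr : (4 : ℝ) ≤ pr N := by exact_mod_cast four_le_pr N
  have hD : (1 : ℝ) ≤ pD N := by exact_mod_cast pD_pos N
  set m : ℕ := 1 + 2 * (ps N + 1) with hm
  have hK : (pK N : ℝ) / 6 = (3 : ℝ) ^ m := by
    unfold pK; push_cast; ring
  have hs0 : (0 : ℝ) ≤ (ps N : ℝ) + 1 := by positivity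
  -- `log 3 ≥ 1` (this is `BetaSieve.one_le_log_three` of `RosserSieveSums.lean`, inlined to keep
  -- the import closure small)
  have one_le_log_three : (1 : ℝ) ≤ Real.log 3 := by
    rw [Real.le_log_iff_exp_le (by norm_num)]
    have := Real.exp_one_lt_d9
    linarith
  -- `log (rK/6) ≥ m`
  have h3m : (1 : ℝ) ≤ (3 : ℝ) ^ m := one_le_pow₀ (by norm_num)
  have hlog : (m : ℝ) ≤ Real.log ((pr N : ℝ) * pK N / 6) := by
    have h1 : (3 : ℝ) ^ m ≤ (pr N : ℝ) * pK N / 6 := by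
      rw [mul_div_assoc, hK]
      nlinarith
    calc (m : ℝ) = m * 1 := (mul_one _).symm
      _ ≤ m * Real.log 3 := mul_le_mul_of_nonneg_left one_le_log_three (by positivity)
      _ = Real.log ((3 : ℝ) ^ m) := by rw [Real.log_pow]
      _ ≤ Real.log ((pr N : ℝ) * pK N / 6) := Real.log_le_log (by positivity) h1
  have hm' : (m : ℝ) = 1 + 2 * ((ps N : ℝ) + 1) := by rw [hm]; push_cast; ring
  have hlog0 : 0 ≤ Real.log ((pr N : ℝ) * pK N / 6) := le_trans (by positivity) hlog
  have hfrac : 2 * ((ps N : ℝ) + 1) / pr N ≤ 2 * ((ps N : ℝ) + 1) := by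
    rw [div_le_iff₀ (by linarith)]
    nlinarith
  calc 1 + 2 * ((ps N : ℝ) + 1) / pr N ≤ 1 + 2 * ((ps N : ℝ) + 1) := by linarith
    _ = m := hm'.symm
    _ ≤ Real.log ((pr N : ℝ) * pK N / 6) := hlog
    _ = 1 * Real.log ((pr N : ℝ) * pK N / 6) := (one_mul _).symm
    _ ≤ (pD N : ℝ) * Real.log ((pr N : ℝ) * pK N / 6) := mul_le_mul_of_nonneg_right hD hlog0

/-- **The rate inequality** `2 D^B (r+2)^B 2^{10MD} ≤ r^{6M-B}` for the chosen parameters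
(everything is a power of `2`; it reduces to `1 + B(N+4D+1) ≤ 2MD`). [folklore] -/
theorem rate_ineq (N : ℕ) :
    2 * pD N ^ pB N * (pr N + 2) ^ pB N * 2 ^ (10 * pM N * pD N) ≤ pr N ^ (6 * pM N - pB N) := by
  set D := pD N with hD
  set B := pB N with hB
  set M := pM N with hM
  have hD1 : 1 ≤ D := pD_pos N
  have hB1 : 1 ≤ B := pB_pos N
  have h6 : B ≤ 6 * M := by have := pM_ge N; rw [← hB, ← hM] at this; omega
  have hr : pr N = 4 ^ D := rfl
  have hDdef : D = 2 ^ N := rfl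
  have hMdef : M = B * (N + 4 * D + 2) := rfl
  -- `r + 2 ≤ 2^(2D+1)`
  have hr2 : pr N + 2 ≤ 2 ^ (2 * D + 1) := by
    rw [hr, pow_succ, pow_mul]
    norm_num
    have : 4 ≤ 4 ^ D := by
      calc 4 = 4 ^ 1 := by norm_num
        _ ≤ 4 ^ D := Nat.pow_le_pow_right (by norm_num) hD1
    omega
  have h1 : (pr N + 2) ^ B ≤ 2 ^ ((2 * D + 1) * B) := by
    rw [pow_mul]; exact Nat.pow_le_pow_left hr2 B
  have h2 : D ^ B = 2 ^ (N * B) := by rw [hDdef, ← pow_mul]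
  have h3 : pr N ^ (6 * M - B) = 2 ^ (2 * D * (6 * M - B)) := by
    rw [hr, show (4 : ℕ) = 2 ^ 2 by norm_num, ← pow_mul, ← pow_mul, Nat.mul_assoc]
  -- exponent inequality
  have hexp : 1 + N * B + (2 * D + 1) * B + 10 * M * D ≤ 2 * D * (6 * M - B) := by
    zify [h6]
    have hD1' : (1 : ℤ) ≤ D := by exact_mod_cast hD1
    have hB1' : (1 : ℤ) ≤ B := by exact_mod_cast hB1
    have hM' : (M : ℤ) = B * (N + 4 * D + 2) := by exact_mod_cast hMdef
    have hN0 : (0 : ℤ) ≤ N := by positivity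
    have hNB : (0 : ℤ) ≤ (N : ℤ) * B * (2 * D - 1) := by
      have : (0 : ℤ) ≤ 2 * D - 1 := by linarith
      positivity
    nlinarith [mul_le_mul_of_nonneg_right hD1' (by positivity : (0 : ℤ) ≤ (D : ℤ) * B),
      mul_le_mul_of_nonneg_right hB1' (by positivity : (0 : ℤ) ≤ (D : ℤ) * D)]
  calc 2 * D ^ B * (pr N + 2) ^ B * 2 ^ (10 * M * D)
      ≤ 2 * 2 ^ (N * B) * 2 ^ ((2 * D + 1) * B) * 2 ^ (10 * M * D) := by
        rw [h2]; gcongr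
    _ = 2 ^ (1 + N * B + (2 * D + 1) * B + 10 * M * D) := by
        rw [pow_add, pow_add, pow_add, pow_one]
    _ ≤ 2 ^ (2 * D * (6 * M - B)) := Nat.pow_le_pow_right (by norm_num) hexp
    _ = pr N ^ (6 * M - B) := h3.symm

/-! ### The size of the linear forms -/

/-- Chebyshev's constant `K₀ = d_{3750}^3 2^{150}` of `LcmUptoCubeBound`: `d_m^3 ≤ K₀ 32^m`. [folklore] -/
def K₀ : ℝ := ((Nat.lcmUpto (30 * 125)) ^ 3 * 2 ^ 150 : ℕ)

/-- `d_m^3 ≤ K₀ 32^m` in `ℝ`. [folklore] -/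
theorem dn_pow_three_le (m : ℕ) : dn m ^ 3 ≤ K₀ * (32 : ℝ) ^ m := by
  have h := Literature.NumberTheory.LFunctions.lcmUpto_pow_three_le m
  unfold dn K₀
  exact_mod_cast h

/-- **Exponential smallness of `d_{Dn}^{s+1} Cₙ`** for the chosen parameters:
`d_{Dn}^{s+1} Cₙ ≤ K₀^{2M} (r+2) 2^{-n}` (from `d_m^3 ≤ K₀ 32^m` and `rate_ineq`). [folklore] -/
theorem growth_bound (N n : ℕ) :
    dn (pD N * n) ^ (ps N + 1) * Cn (pr N) (pD N) (ps N) n ≤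
      K₀ ^ (2 * pM N) * ((pr N : ℝ) + 2) * (1 / 2) ^ n := by
  set D := pD N with hD
  set r := pr N with hr
  set B := pB N with hB
  set M := pM N with hM
  have hs1 : ps N + 1 = 6 * M := ps_succ N
  have hBdef : B = (2 * r + 1) * D := rfl
  have hL : Lnum r D n = B * n := by rw [Lnum, hBdef]
  have hk : ps N + 1 - (2 * r + 1) * D = 6 * M - B := by rw [hs1, hBdef]
  have hr0 : (0 : ℝ) < r := by have := four_le_pr N; rw [← hr] at this; exact_mod_cast (by omega : 0 < r)
  have hD0 : (0 : ℝ) < D := by exact_mod_cast pD_pos N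
  have hK0 : 0 ≤ K₀ := by unfold K₀; exact Nat.cast_nonneg _
  -- Step 1: `d_{Dn}^{s+1} ≤ K₀^{2M} 32^{2M·Dn}`
  have h1 : dn (D * n) ^ (ps N + 1) ≤ K₀ ^ (2 * M) * ((32 : ℝ) ^ (2 * M * D)) ^ n := by
    rw [hs1, show 6 * M = 3 * (2 * M) by ring, pow_mul]
    calc (dn (D * n) ^ 3) ^ (2 * M) ≤ (K₀ * (32 : ℝ) ^ (D * n)) ^ (2 * M) :=
          pow_le_pow_left₀ (pow_nonneg (dn_pos _).le 3) (dn_pow_three_le _) _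
      _ = K₀ ^ (2 * M) * ((32 : ℝ) ^ (2 * M * D)) ^ n := by
          rw [mul_pow, ← pow_mul, ← pow_mul]
          congr 2; ring
  -- Step 2: `Cₙ = (r+2) (D^B (r+2)^B)^n / (r^{6M-B})^n`
  have h2 : Cn r D (ps N) n =
      ((r : ℝ) + 2) * (((D : ℝ) ^ B * ((r : ℝ) + 2) ^ B) ^ n / ((r : ℝ) ^ (6 * M - B)) ^ n) := by
    unfold Cn
    rw [hL, hk, pow_succ, ← pow_mul, mul_comm n (6 * M - B), pow_mul, pow_mul, pow_mul, mul_pow]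
    ring
  -- Step 3: the bracket is `≤ 1/2`
  have hrate : (2 : ℝ) * (D : ℝ) ^ B * ((r : ℝ) + 2) ^ B * (2 : ℝ) ^ (10 * M * D) ≤ (r : ℝ) ^ (6 * M - B) := by
    have := rate_ineq N
    rw [← hD, ← hr, ← hB, ← hM] at this
    exact_mod_cast this
  have h32 : ((32 : ℝ) ^ (2 * M * D)) = (2 : ℝ) ^ (10 * M * D) := by
    rw [show (32 : ℝ) = 2 ^ 5 by norm_num, ← pow_mul]; congr 1; ring
  have hbr : (32 : ℝ) ^ (2 * M * D) * ((D : ℝ) ^ B * ((r : ℝ) + 2) ^ B) / (r : ℝ) ^ (6 * M - B) ≤ 1 / 2 := by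
    rw [div_le_div_iff₀ (by positivity) (by norm_num), h32]
    linarith
  have hbr0 : 0 ≤ (32 : ℝ) ^ (2 * M * D) * ((D : ℝ) ^ B * ((r : ℝ) + 2) ^ B) / (r : ℝ) ^ (6 * M - B) := by
    positivity
  -- assemble
  rw [h2]
  calc dn (D * n) ^ (ps N + 1) *
        (((r : ℝ) + 2) * (((D : ℝ) ^ B * ((r : ℝ) + 2) ^ B) ^ n / ((r : ℝ) ^ (6 * M - B)) ^ n))
      ≤ K₀ ^ (2 * M) * ((32 : ℝ) ^ (2 * M * D)) ^ n *
        (((r : ℝ) + 2) * (((D : ℝ) ^ B * ((r : ℝ) + 2) ^ B) ^ n / ((r : ℝ) ^ (6 * M - B)) ^ n)) :=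
        mul_le_mul_of_nonneg_right h1 (by positivity)
    _ = K₀ ^ (2 * M) * ((r : ℝ) + 2) *
        ((32 : ℝ) ^ (2 * M * D) * ((D : ℝ) ^ B * ((r : ℝ) + 2) ^ B) / (r : ℝ) ^ (6 * M - B)) ^ n := by
        rw [div_pow, mul_pow]; ring
    _ ≤ K₀ ^ (2 * M) * ((r : ℝ) + 2) * (1 / 2) ^ n := by
        exact mul_le_mul_of_nonneg_left (pow_le_pow_left₀ hbr0 hbr n)
          (mul_nonneg (pow_nonneg hK0 _) (by positivity))

/-! ### The main theorem -/

/-- The sample series `T = ∑_{m ≥ 0} R_n((m+1)/d)` equals `d · S(d)`. [folklore] -/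
theorem tsum_eq_mul_S {r D s n d : ℕ} (hd : 0 < d) :
    ∑' m : ℕ, Rfun r D s n (((m : ℝ) + 1) / d) = (d : ℝ) * S r D s n d := by
  unfold S term
  have : (d : ℝ) ≠ 0 := by exact_mod_cast hd.ne'
  field_simp

/-- **Beyond every `N` there is an irrational `ζ(2k+1)`** (Rivoal 2000; Ball–Rivoal 2001; here by
the elementary method of Zudilin 2018 / Sprang 2018 with the sampling estimates of
`OddZetaSampling` in place of Sprang's Lemma 2.1): for every `N` there is `k > N` with
`ζ(2k+1) ∉ ℚ`. [cite: Sprang2018OddZeta, Theorem 3.1 and Corollary 3.2] -/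
theorem exists_irrational_zetaValue_odd_gt (N : ℕ) :
    ∃ k : ℕ, N < k ∧ Irrational (zetaValue (2 * k + 1)) := by
  classical
  -- parameters
  set D := pD N with hDdef
  set r := pr N with hrdef
  set s := ps N with hsdef
  set K := pK N with hKdef
  have hD : 0 < D := pD_pos N
  have hr : 1 ≤ r := le_trans (by norm_num) (four_le_pr N)
  have hs' : (2 * r + 1) * D + 2 ≤ s + 1 := ps_large N
  have hsodd : Odd s := ps_odd N
  have hK : 0 < K := pK_pos N
  have hwin : 1 + 2 * ((s : ℝ) + 1) / r ≤ D * Real.log ((r : ℝ) * K / 6) := window_holds N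
  have hD' : (0 : ℝ) < D := by exact_mod_cast hD
  obtain ⟨w, hW, hw0⟩ := exists_weights N
  -- `n = 2ν + 2`
  set nn : ℕ → ℕ := fun ν => 2 * ν + 2 with hnn
  have hn1 : ∀ ν, 1 ≤ nn ν := fun ν => by simp only [hnn]; omega
  have hLeven : ∀ ν, Even (Lnum r D (nn ν)) := fun ν => by
    unfold Lnum; exact ⟨(2 * r + 1) * D * (ν + 1), by simp only [hnn]; ring⟩
  have key : ∀ ν : ℕ, ∃ (P : ℕ → ℝ) (ρ : ℕ → ℝ), (∀ i, Even i → P i = 0) ∧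
      (∀ i, IsZ (2 * dn (D * nn ν) ^ (s + 1) * P i)) ∧
      (∀ d, d ∣ D → IsZ (2 * dn (D * nn ν) ^ (s + 1) * ρ d)) ∧
      ∀ d, d ∣ D → HasSum (fun m : ℕ => Rfun r D s (nn ν) (((m : ℝ) + 1) / d))
          (∑ i ∈ Icc 2 (s + 1), P i * (d : ℝ) ^ i * zetaValue i - ρ d) :=
    fun ν => lattice_linear_forms (hn1 ν) hD hr (hLeven ν) hsodd hs'
  choose P ρ hP0 hPZ hρZ hsum using key
  -- the divisors `2^c`, `c ≤ N`
  have hdvd : ∀ c, c < N + 1 → 2 ^ c ∣ D := fun c hc => by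
    show 2 ^ c ∣ pD N; unfold pD; exact pow_dvd_pow 2 (by omega)
  have h2c : ∀ c : ℕ, (0 : ℝ) < (2 : ℝ) ^ c := fun c => by positivity
  have h2cD : ∀ c, c < N + 1 → (2 : ℝ) ^ c ≤ D := fun c hc => by
    have : ((2 ^ c : ℕ) : ℝ) ≤ ((pD N : ℕ) : ℝ) := by
      exact_mod_cast Nat.le_of_dvd (pD_pos N) (hdvd c hc)
    push_cast at this
    exact this
  -- integer data
  choose zP hzP using hPZ
  have hρZ' : ∀ ν c, ∃ z : ℤ,
      (if c < N + 1 then 2 * dn (D * nn ν) ^ (s + 1) * ρ ν (2 ^ c) else 0) = z := by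
    intro ν c
    by_cases h : c < N + 1
    · obtain ⟨z, hz⟩ := hρZ ν (2 ^ c) (hdvd c h); exact ⟨z, by rw [if_pos h, hz]⟩
    · exact ⟨0, by rw [if_neg h]; simp⟩
  choose zρ hzρ using hρZ'
  -- the linear forms
  set Mult : ℕ → ℝ := fun ν => 2 * dn (D * nn ν) ^ (s + 1) with hMult
  have hMult_pos : ∀ ν, 0 < Mult ν := fun ν => by
    simp only [hMult]; exact mul_pos two_pos (pow_pos (dn_pos _) _)
  set T : ℕ → ℕ → ℝ := fun ν d => ∑' m : ℕ, Rfun r D s (nn ν) (((m : ℝ) + 1) / d) with hT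
  have hTval : ∀ ν c, c < N + 1 →
      T ν (2 ^ c) = ∑ i ∈ Icc 2 (s + 1), P ν i * ((2 : ℝ) ^ c) ^ i * zetaValue i - ρ ν (2 ^ c) := by
    intro ν c hc
    have := (hsum ν (2 ^ c) (hdvd c hc)).tsum_eq
    simp only [hT]
    push_cast at this ⊢
    exact this
  have hTS : ∀ ν c, T ν (2 ^ c) = (2 : ℝ) ^ c * S r D s (nn ν) (2 ^ c) := by
    intro ν c
    have := tsum_eq_mul_S (r := r) (D := D) (s := s) (n := nn ν) (d := 2 ^ c) (by positivity)
    simp only [hT]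
    push_cast at this ⊢
    exact this
  set ℓ : ℕ → ℝ := fun ν => Mult ν * ∑ c ∈ range (N + 1), (w c : ℝ) * T ν (2 ^ c) with hℓ
  set V : ℕ → ℤ := fun i => ∑ c ∈ range (N + 1), w c * (2 ^ c) ^ i with hV
  set I : Finset ℕ := (Icc 2 (s + 1)).filter (fun i => Odd i ∧ 2 * N + 3 ≤ i) with hI
  -- expansion of `ℓ` over `Icc 2 (s+1)`
  have hℓ1 : ∀ ν, ℓ ν = -((∑ c ∈ range (N + 1), w c * zρ ν c : ℤ) : ℝ) +
      ∑ i ∈ Icc 2 (s + 1), ((V i * zP ν i : ℤ) : ℝ) * zetaValue i := by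
    intro ν
    simp only [hℓ]
    rw [mul_sum]
    have e1 : ∀ c ∈ range (N + 1), Mult ν * ((w c : ℝ) * T ν (2 ^ c)) =
        (w c : ℝ) * (∑ i ∈ Icc 2 (s + 1), (zP ν i : ℝ) * ((2 : ℝ) ^ c) ^ i * zetaValue i) -
          (w c : ℝ) * (zρ ν c : ℝ) := by
      intro c hc
      have hc' : c < N + 1 := mem_range.mp hc
      have hρ' : (zρ ν c : ℝ) = 2 * dn (D * nn ν) ^ (s + 1) * ρ ν (2 ^ c) := by
        rw [← hzρ ν c, if_pos hc']
      have : ∀ i ∈ Icc 2 (s + 1), (zP ν i : ℝ) * ((2 : ℝ) ^ c) ^ i * zetaValue i =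
          Mult ν * (P ν i * ((2 : ℝ) ^ c) ^ i * zetaValue i) := by
        intro i _
        rw [← hzP ν i]
        simp only [hMult]
        ring
      rw [hTval ν c hc', hρ', sum_congr rfl this, ← mul_sum]
      simp only [hMult]
      ring
    rw [sum_congr rfl e1, sum_sub_distrib]
    have e2 : ∑ c ∈ range (N + 1), (w c : ℝ) *
        ∑ i ∈ Icc 2 (s + 1), (zP ν i : ℝ) * ((2 : ℝ) ^ c) ^ i * zetaValue i =
        ∑ i ∈ Icc 2 (s + 1), ((V i * zP ν i : ℤ) : ℝ) * zetaValue i := by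
      simp_rw [mul_sum]
      rw [sum_comm]
      refine sum_congr rfl fun i _ => ?_
      simp only [hV]
      push_cast
      rw [sum_mul, sum_mul]
      refine sum_congr rfl fun c _ => ?_
      ring
    rw [e2]
    push_cast
    ring
  -- the coefficients outside `I` vanish
  have hvan : ∀ ν, ∀ i ∈ Icc 2 (s + 1), i ∉ I → ((V i * zP ν i : ℤ) : ℝ) * zetaValue i = 0 := by
    intro ν i hi hiI
    have hi2 : 2 ≤ i := (mem_Icc.mp hi).1
    have hnot : ¬(Odd i ∧ 2 * N + 3 ≤ i) := fun h => hiI (mem_filter.mpr ⟨hi, h⟩)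
    rcases Nat.even_or_odd i with he | ho
    · -- even `i`: `P i = 0`
      have h1 : (zP ν i : ℝ) = 0 := by rw [← hzP ν i, hP0 ν i he, mul_zero]
      push_cast
      rw [h1]; ring
    · -- odd `i ≤ 2N+1`: the weights kill it
      have hlt : i < 2 * N + 3 := by
        by_contra h; exact hnot ⟨ho, by omega⟩
      obtain ⟨k, hk⟩ := ho
      have hk1 : 1 ≤ k := by omega
      have hkN : k ≤ N := by omega
      have hVi : V i = 0 := by
        simp only [hV]; rw [hk]; exact hw0 k hk1 hkN
      push_cast
      rw [show ((V i : ℤ) : ℝ) = 0 by rw [hVi]; simp]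
      ring
  have hℓ2 : ∀ ν, ℓ ν = ((-(∑ c ∈ range (N + 1), w c * zρ ν c) : ℤ) : ℝ) +
      ∑ i : I, ((V i * zP ν i : ℤ) : ℝ) * zetaValue (i : ℕ) := by
    intro ν
    rw [hℓ1 ν, Finset.sum_coe_sort I (fun i => ((V i * zP ν i : ℤ) : ℝ) * zetaValue i),
      ← Finset.sum_subset (filter_subset _ (Icc 2 (s + 1))) (hvan ν)]
    push_cast
    ring
  -- smallness
  have hsmall : Tendsto ℓ atTop (𝓝 0) := by
    set Wsum : ℝ := ∑ c ∈ range (N + 1), |(w c : ℝ)| with hWsum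
    set C : ℝ := 4 * (D : ℝ) ^ (s + 1) * Wsum * (K₀ ^ (2 * pM N) * ((r : ℝ) + 2)) with hC
    have hbound : ∀ ν, |ℓ ν| ≤ C * (1 / 2) ^ (nn ν) := by
      intro ν
      have hSnn : ∀ c, c < N + 1 → 0 ≤ S r D s (nn ν) (2 ^ c) := fun c hc =>
        S_nonneg hD (hdvd c hc)
      have hSle : ∀ c, c < N + 1 → S r D s (nn ν) (2 ^ c) ≤ 2 * Cn r D s (nn ν) * (D : ℝ) ^ s :=
        fun c hc => S_le hD (hdvd c hc) hr hs'
      have hCn : 0 ≤ Cn r D s (nn ν) := (Cn_pos (s := s) (n := nn ν) hD hr).le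
      have h1 : |∑ c ∈ range (N + 1), (w c : ℝ) * T ν (2 ^ c)| ≤
          Wsum * (2 * (D : ℝ) ^ (s + 1) * Cn r D s (nn ν)) := by
        calc |∑ c ∈ range (N + 1), (w c : ℝ) * T ν (2 ^ c)|
            ≤ ∑ c ∈ range (N + 1), |(w c : ℝ) * T ν (2 ^ c)| := abs_sum_le_sum_abs _ _
          _ ≤ ∑ c ∈ range (N + 1), |(w c : ℝ)| * (2 * (D : ℝ) ^ (s + 1) * Cn r D s (nn ν)) := by
              refine sum_le_sum fun c hc => ?_
              have hc' := mem_range.mp hc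
              rw [abs_mul, hTS ν c, abs_of_nonneg (mul_nonneg (h2c c).le (hSnn c hc'))]
              refine mul_le_mul_of_nonneg_left ?_ (abs_nonneg _)
              calc (2 : ℝ) ^ c * S r D s (nn ν) (2 ^ c) ≤ D * (2 * Cn r D s (nn ν) * (D : ℝ) ^ s) :=
                    mul_le_mul (h2cD c hc') (hSle c hc') (hSnn c hc') hD'.le
                _ = 2 * (D : ℝ) ^ (s + 1) * Cn r D s (nn ν) := by rw [pow_succ]; ring
          _ = Wsum * (2 * (D : ℝ) ^ (s + 1) * Cn r D s (nn ν)) := by rw [hWsum, sum_mul]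
      have hWsum0 : 0 ≤ Wsum := sum_nonneg fun c _ => abs_nonneg _
      have hg := growth_bound N (nn ν)
      rw [← hDdef, ← hrdef, ← hsdef] at hg
      simp only [hℓ]
      rw [abs_mul, abs_of_pos (hMult_pos ν)]
      simp only [hMult]
      calc 2 * dn (D * nn ν) ^ (s + 1) * |∑ c ∈ range (N + 1), (w c : ℝ) * T ν (2 ^ c)|
          ≤ 2 * dn (D * nn ν) ^ (s + 1) * (Wsum * (2 * (D : ℝ) ^ (s + 1) * Cn r D s (nn ν))) :=
            mul_le_mul_of_nonneg_left h1 (mul_nonneg zero_le_two (pow_nonneg (dn_pos _).le _))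
        _ = 4 * (D : ℝ) ^ (s + 1) * Wsum * (dn (D * nn ν) ^ (s + 1) * Cn r D s (nn ν)) := by ring
        _ ≤ 4 * (D : ℝ) ^ (s + 1) * Wsum * (K₀ ^ (2 * pM N) * ((r : ℝ) + 2) * (1 / 2) ^ nn ν) :=
            mul_le_mul_of_nonneg_left hg (mul_nonneg (by positivity) hWsum0)
        _ = C * (1 / 2) ^ (nn ν) := by rw [hC]; ring
    have hgeom : Tendsto (fun ν => C * (1 / 2 : ℝ) ^ (nn ν)) atTop (𝓝 0) := by
      have h1 : Tendsto (fun n : ℕ => (1 / 2 : ℝ) ^ n) atTop (𝓝 0) :=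
        tendsto_pow_atTop_nhds_zero_of_lt_one (by norm_num) (by norm_num)
      have h2 : Tendsto nn atTop atTop :=
        tendsto_atTop_mono (fun ν => by show ν ≤ 2 * ν + 2; omega) tendsto_id
      simpa using (h1.comp h2).const_mul C
    exact squeeze_zero_norm (fun ν => by rw [Real.norm_eq_abs]; exact hbound ν) hgeom
  -- non-vanishing for all large `ν`
  have hne : ∃ᶠ ν in atTop, ℓ ν ≠ 0 := by
    set Wr : ℝ := ((∑ c ∈ range (N + 1), w c * 2 ^ c : ℤ) : ℝ) with hWr_def
    have hWr : Wr ≠ 0 := by rw [hWr_def]; exact_mod_cast hW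
    have hWr' : Wr = ∑ c ∈ range (N + 1), (w c : ℝ) * (2 : ℝ) ^ c := by rw [hWr_def]; push_cast; rfl
    set Wabs : ℝ := ∑ c ∈ range (N + 1), |(w c : ℝ)| * (2 : ℝ) ^ c with hWabs
    have hWabs0 : 0 ≤ Wabs := sum_nonneg fun c _ => by positivity
    set θ : ℝ := |Wr| / (2 * Wabs + 1) with hθ
    have hθpos : 0 < θ := div_pos (abs_pos.mpr hWr) (by positivity)
    have hθW : Wabs * θ ≤ |Wr| / 2 := by
      rw [hθ, mul_div_assoc', div_le_div_iff₀ (by positivity) (by norm_num)]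
      nlinarith [abs_nonneg Wr]
    have hev := eventually_abs_S_sub_S_le (s := s) hD hr hs' hK hwin hθpos
    have h2 : Tendsto nn atTop atTop :=
      tendsto_atTop_mono (fun ν => by show ν ≤ 2 * ν + 2; omega) tendsto_id
    have hev' := h2.eventually hev
    refine Filter.Eventually.frequently ?_
    filter_upwards [hev'] with ν hν
    set SD := S r D s (nn ν) D with hSD
    have hSDpos : 0 < SD := S_pos hD hr hs'
    set Λ := ∑ c ∈ range (N + 1), (w c : ℝ) * T ν (2 ^ c) with hΛ
    have hdiff : |Λ - Wr * SD| ≤ |Wr| / 2 * SD := by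
      have e : Λ - Wr * SD = ∑ c ∈ range (N + 1), (w c : ℝ) * (2 : ℝ) ^ c * (S r D s (nn ν) (2 ^ c) - SD) := by
        rw [hΛ, hWr', sum_mul, ← sum_sub_distrib]
        refine sum_congr rfl fun c _ => ?_
        rw [hTS ν c]; ring
      rw [e]
      calc |∑ c ∈ range (N + 1), (w c : ℝ) * (2 : ℝ) ^ c * (S r D s (nn ν) (2 ^ c) - SD)|
          ≤ ∑ c ∈ range (N + 1), |(w c : ℝ) * (2 : ℝ) ^ c * (S r D s (nn ν) (2 ^ c) - SD)| :=
            abs_sum_le_sum_abs _ _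
        _ ≤ ∑ c ∈ range (N + 1), |(w c : ℝ)| * (2 : ℝ) ^ c * (θ * SD) := by
            refine sum_le_sum fun c hc => ?_
            have hc' := mem_range.mp hc
            rw [abs_mul, abs_mul, abs_of_pos (h2c c)]
            have hD2 : D ∣ D := dvd_refl D
            exact mul_le_mul_of_nonneg_left (hν (2 ^ c) D (hdvd c hc') hD2) (by positivity)
        _ = Wabs * θ * SD := by
            rw [hWabs, sum_mul, sum_mul]
            exact sum_congr rfl fun c _ => by ring
        _ ≤ |Wr| / 2 * SD := mul_le_mul_of_nonneg_right hθW hSDpos.le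
    have hΛne : Λ ≠ 0 := by
      intro h0
      rw [h0, zero_sub, abs_neg, abs_mul, abs_of_pos hSDpos] at hdiff
      have : 0 < |Wr| * SD := mul_pos (abs_pos.mpr hWr) hSDpos
      linarith
    simp only [hℓ]
    exact mul_ne_zero (hMult_pos ν).ne' hΛne
  -- the criterion
  obtain ⟨i, hi⟩ := exists_irrational_of_integerLinearForms (ι := I)
    (fun i => zetaValue (i : ℕ)) ℓ (fun ν => -(∑ c ∈ range (N + 1), w c * zρ ν c))
    (fun ν i => V i * zP ν i) hℓ2 hsmall hne
  have hiI : (i : ℕ) ∈ (Icc 2 (s + 1)).filter (fun i => Odd i ∧ 2 * N + 3 ≤ i) := by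
    rw [← hI]; exact i.2
  obtain ⟨_, ⟨k, hk⟩, hge⟩ := mem_filter.mp hiI
  refine ⟨k, by omega, ?_⟩
  rw [← hk]
  exact hi

/-- **Infinitely many odd zeta values are irrational** (Rivoal 2000; Ball–Rivoal 2001), in the
form of the tree's fact `infinite_setOf_irrational_zetaValue_odd`: the set
`{k : ℕ | ζ(2k+1) ∉ ℚ}` is infinite. [cite: Sprang2018OddZeta, Corollary 3.2] -/
theorem setOf_irrational_zetaValue_odd_infinite :
    {k : ℕ | Irrational (zetaValue (2 * k + 1))}.Infinite :=
  Set.infinite_of_forall_exists_gt fun N => by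
    obtain ⟨k, hk, hirr⟩ := exists_irrational_zetaValue_odd_gt N
    exact ⟨k, hirr, hk⟩

end OddZetaFinal

end Literature.NumberTheory.Transcendental
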